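import Summits.QuantumFields.YangMills.Theorems.ParabolicTrajectoryLatticeGapOnTrajectoryStubTransferSymMain
import HarnessLib

/-!
# Crux `LatticeGapOnTrajectory` (stmt-QuantumFields-10523), line `orbit-kantorovich-finite-size`
# (reshape 4b): the registered stub `stub_transferSym` (lead c2)

`--supports stmt-QuantumFields-10523`. The transfer clause of the crux for reflection-SYMMETRIC,
polynomially bounded witness renormalisations `sch' ~ sch`, from slab clustering in cluster-expansion
format, physical volume growth `a_k L_k / log(1/a_k) → ∞` and site reflection positivity of the odd
tori, at the SAME rate `Δ` — the one-scheme theorem `Transfer.hasMassGap_of_slabClustering` of the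
previous file transported along `sch'.a = sch.a`, `sch'.β = sch.β`, `sch'.L = sch.L`.
References: Osterwalder–Seiler 1978 §2; Glimm–Jaffe 1987 §6.1, §19.7.
-/

open scoped ComplexConjugate ComplexOrder
open Filter MeasureTheory
open Literature.MathematicalPhysics.QuantumLattice Literature.MathematicalPhysics.QuantumFieldTheory

noncomputable section

namespace Summit.QuantumFields.YangMills.Cruxes.LatticeGapOnTrajectory.OrbitKantorovichFiniteSize

/-- **stub_transferSym** (registered stub of the line `orbit-kantorovich-finite-size`, reshape 4):
the transfer clause of the crux for reflection-SYMMETRIC, polynomially bounded witness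
renormalisations, from slab clustering in cluster-expansion format, physical volume growth
`a_k L_k / log(1/a_k) → ∞` and site reflection positivity of the odd tori — same rate `Δ`.
[cite: GlimmJaffe1987, §6.1 and §19.7] [cite: OsterwalderSeiler1978, §2] -/
theorem stub_transferSym :
    ∀ (G : Type) [Group G] [TopologicalSpace G] [IsTopologicalGroup G] [CompactSpace G]
      [MeasurableSpace G] [BorelSpace G] (r : LatticeRep G) (M : ℕ) (sch : SpeciesScheme (YMSpecies G))
      (n : ℕ → ℕ) (Δ : ℝ), 2 ≤ M → (∀ k, sch.a k = ((M : ℝ) ^ n k)⁻¹) → Tendsto sch.β atTop atTop →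
      Tendsto (fun k => sch.a k * sch.L k / Real.log (sch.a k)⁻¹) atTop atTop →
      (∀ {β : ℝ}, 0 ≤ β → ∀ {S : ℕ}, 1 ≤ S → ∀ (F : GaugeConfig 4 (2 * S + 1) G → ℂ), Measurable F →
        (∃ C : ℝ, ∀ U, ‖F U‖ ≤ C) → ∀ {w : ℕ}, w < S →
        DependsOn F {e : Edge 4 (2 * S + 1) | 1 ≤ (e.1 0).val ∧ (e.1 0).val ≤ w} →
          0 ≤ wilsonExpectation r.ρ β fun U => conj (F U.negReflect) * F U) →
      (∃ (p : ℕ) (K : ℝ), 0 ≤ K ∧ ∀ᶠ k in atTop,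
          ∀ (w N : ℕ) (X : GaugeConfig 4 (sch.side k) G → ℂ) (B : ℝ), Measurable X → (∀ U, ‖X U‖ ≤ B) →
            DependsOn X {e : Edge 4 (sch.side k) | 1 ≤ (e.1 0).val ∧ (e.1 0).val ≤ w} →
            N + 2 * w ≤ sch.L k →
              ‖osCorr (wilsonMeasure r.ρ (sch.β k)) GaugeConfig.negReflect (torusTimeShift (sch.side k) N) X X‖ ≤
                K * ((sch.a k)⁻¹ * ((w : ℝ) + 1) * ((sch.L k : ℝ) + 1)) ^ p * B ^ 2 *
                  Real.exp (-Δ * sch.a k * N)) →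
      ∀ sch' : SpeciesScheme (YMSpecies G), sch'.a = sch.a → sch'.β = sch.β → sch'.L = sch.L →
        sch'.IsReflectionSymmetric →
        (∀ s, ∃ (q : ℕ) (K : ℝ), ∀ k, |sch'.c s k| ≤ K * ((sch'.a k)⁻¹) ^ q ∧ |sch'.m s k| ≤ K * ((sch'.a k)⁻¹) ^ q) →
        ∀ T : OSData (YMSpecies G) 4, IsYangMillsFor r sch' T → T.HasMassGap Δ := by
  intro G _ _ _ _ _ _ r M sch n Δ hM hshape hβ hvol hRP hclust sch' ha hb hL hsym hpoly T hT
  obtain ⟨a', ha', hta', β', L', htL', c', m'⟩ := sch'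
  have ha1 : a' = sch.a := ha
  have hβ1 : β' = sch.β := hb
  have hL1 : L' = sch.L := hL
  subst ha1 hβ1 hL1
  exact Transfer.hasMassGap_of_slabClustering r hM (S := ⟨sch.a, ha', hta', sch.β, sch.L, htL', c', m'⟩)
    hshape hβ hvol hRP hclust hsym hpoly hT

end Summit.QuantumFields.YangMills.Cruxes.LatticeGapOnTrajectory.OrbitKantorovichFiniteSize

end
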